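import Literature.Combinatorics.SimpleGraph.BondySimonovitsLemma1
import Mathlib.Combinatorics.SimpleGraph.Metric
import Mathlib.Combinatorics.Enumerative.DoubleCounting

/-!
# Bondy–Simonovits 1974 — Lemma 2: breadth-first search in a bipartite graph of large minimum degree

Second fully proved ingredient of the discharge of
`Literature.Combinatorics.SimpleGraph.BondySimonovits1974_thm1` (see `BondySimonovits.lean` and the
Lemma-1 file `BondySimonovitsLemma1.lean`). **Lemma 2** of [BondySimonovits1974] (p. 100): *"Let `Gⁿ`
be a bipartite graph in which every vertex has valence at least `s ≥ max{5 l n^{1/l}, 50 l}`. Then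
`Gⁿ` contains a `C^{2l}`."* It is proved here as `lemma2`, with the hypothesis `s ≥ 50 l` weakened to
`s ≥ 43 l` (the printed recursion closes as soon as `s² ≥ 40 l s + 100 l²`) and with the valence
condition required only at the vertices reachable from the BFS root `x` (which is all the proof, and
the application in Theorem 1, use).

The printed proof and its rendering.  Fix `x` and let `V_i` be the set of vertices at distance `i`
(BFS levels; Mathlib's `SimpleGraph.dist`, restricted to `Reachable`). If there is no `C^{2l}` then
for `1 ≤ i ≤ l` the graph spanned by `V_{i−1} ∪ V_i` has `e ≤ 4l·v` (inequality (5), `stepBound`),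
whence `|V_i| / |V_{i−1}| ≥ s/5l` ((4), the recursion (7), `lemma2`) and `|V_l| ≥ (s/5l)^l ≥ n`,
contradicting `|V_0| + |V_l| ≤ n`.
* (5) in the paper: for a component `H_j` with lower level `W_j`, a vertex `a ∈ V_p` with two
  internally disjoint monotonic paths to `W_j` and `p` minimal, the red/blue colouring of `W_j`, green
  on the upper level, is `t`-periodic with `t = 2(l − i + p + 1)` (a red–blue path of length `t` would
  close a `C^{2l}`), so Lemma 1 gives `e(H_j) ≤ 2t·v(H_j) ≤ 4l·v(H_j)`. HERE: (a) instead of monotonic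
  paths we use a BFS TREE — a chosen parent map (`exists_parent`), iterated as `anc n` (`anc_spec`);
  `a` is the nearest common ancestor of the lower level `W` (depth `m` found by `Nat.find`), red/blue
  are the classes of `anc (m − 1)` on `W`, and the `2l`-cycle closed up by a red–blue path of length
  `t = 2(l − m)` through the two tree paths is `cycle_of_fork`; (b) instead of summing over the
  components `H_j` we pass to a minimal core of `V_{i−1} ∪ V_i` (`exists_core` of the Lemma-1 file),
  which is automatically connected with inner degrees `> 4l ≥ 2t + 1`, and apply `lemma1` to it
  (`stepBound`, by contradiction).
* Bipartiteness enters exactly as in the paper: adjacent vertices lie on consecutive levels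
  (`dist_adj_of_bipartite`, via the parity of walk lengths `side_eq_iff_even`), so there are no edges
  inside a level (`two_mul_crossSum_eq`, `degree_le_levels`).
* The bipartition is taken as a map `side : V → Bool` with `Adj u v → side u ≠ side v`.

Nothing here is a named fact: every declaration is a theorem (D-0026).

## References

* J. A. Bondy, M. Simonovits, *Cycles of even length in graphs*, J. Combin. Theory Ser. B 16
  (1974) 97–105, doi:10.1016/0095-8956(74)90052-5 — Lemma 2, pp. 100–103 (READ, held
  `paper:doi-10-1016-0095-8956-74-90052-5`). [BondySimonovits1974]
-/

namespace Literature.Combinatorics.SimpleGraph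

namespace BondySimonovits1974

open Finset _root_.SimpleGraph

variable {V : Type*} [Fintype V] [DecidableEq V] {H : _root_.SimpleGraph V} [DecidableRel H.Adj]

/-! ## BFS levels and the BFS tree -/

omit [Fintype V] [DecidableEq V] [DecidableRel H.Adj] in
/-- In a graph with a proper two-colouring `side`, the ends of a walk have the same colour iff the
walk has even length. [folklore] -/
theorem side_eq_iff_even (side : V → Bool) (hside : ∀ u v, H.Adj u v → side u ≠ side v)
    {u v : V} (p : H.Walk u v) : (side u = side v ↔ Even p.length) := by
  induction p with
  | nil => simp
  | @cons a b c h p ih =>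
    rw [Walk.length_cons, Nat.even_add_one, ← ih]
    have h1 := hside _ _ h
    revert h1
    cases side a <;> cases side b <;> cases side c <;> simp

omit [Fintype V] [DecidableEq V] [DecidableRel H.Adj] in
/-- BFS levels in a bipartite graph: the distances from the root of two adjacent vertices differ by
exactly one. [folklore] -/
theorem dist_adj_of_bipartite (side : V → Bool) (hside : ∀ u v, H.Adj u v → side u ≠ side v)
    (x : V) {u v : V} (hadj : H.Adj u v) (hu : H.Reachable x u) :
    H.dist x v = H.dist x u + 1 ∨ H.dist x u = H.dist x v + 1 := by
  have hv : H.Reachable x v := hu.trans hadj.reachable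
  have h1 : H.dist x v ≤ H.dist x u + 1 := by
    have := hadj.reachable.dist_triangle_right x
    rwa [SimpleGraph.dist_eq_one_iff_adj.mpr hadj] at this
  have h2 : H.dist x u ≤ H.dist x v + 1 := by
    have := hadj.symm.reachable.dist_triangle_right x
    rwa [SimpleGraph.dist_eq_one_iff_adj.mpr hadj.symm] at this
  have h3 : H.dist x u ≠ H.dist x v := by
    intro heq
    obtain ⟨pu, hpu⟩ := hu.exists_walk_length_eq_dist
    obtain ⟨pv, hpv⟩ := hv.exists_walk_length_eq_dist
    have eu := side_eq_iff_even side hside pu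
    have ev := side_eq_iff_even side hside pv
    rw [hpu, heq, ← hpv, ← ev] at eu
    have h' := hside _ _ hadj
    revert eu h'
    cases side x <;> cases side u <;> cases side v <;> simp
  omega

omit [Fintype V] [DecidableEq V] [DecidableRel H.Adj] in
/-- BFS parents: a non-root vertex reachable from the root has a neighbour one level down.
[folklore] -/
theorem exists_parent (x : V) {v : V} (hv : H.Reachable x v) (hne : v ≠ x) :
    ∃ w, H.Adj v w ∧ H.Reachable x w ∧ H.dist x w + 1 = H.dist x v := by
  obtain ⟨p, hp⟩ := hv.symm.exists_walk_length_eq_dist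
  cases p with
  | nil => exact absurd rfl hne
  | @cons _ w _ h q =>
    have hw : H.Reachable x w := ⟨q.reverse⟩
    refine ⟨w, h, hw, ?_⟩
    rw [Walk.length_cons, SimpleGraph.dist_comm] at hp
    have h1 : H.dist x w ≤ q.length := by
      have := SimpleGraph.dist_le q.reverse
      rwa [Walk.length_reverse] at this
    have h2 : H.dist x v ≤ H.dist x w + 1 := by
      have := h.symm.reachable.dist_triangle_right x
      rwa [SimpleGraph.dist_eq_one_iff_adj.mpr h.symm] at this
    omega

omit [Fintype V] [DecidableEq V] [DecidableRel H.Adj] in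
/-- BFS tree: iterating a parent map `anc 1` from a vertex at level `d` walks down the levels one at
a time along edges. (`Lv i` is the level `i`, `anc n` the `n`-fold parent.) [folklore] -/
theorem anc_spec (x : V) (Lv : ℕ → Finset V)
    (hLv : ∀ i v, v ∈ Lv i ↔ H.Reachable x v ∧ H.dist x v = i)
    (anc : ℕ → V → V) (hA0 : ∀ v, anc 0 v = v)
    (hAadd : ∀ k n v, anc k (anc n v) = anc (k + n) v)
    (hA1 : ∀ v, H.Reachable x v → v ≠ x →
      H.Adj v (anc 1 v) ∧ H.Reachable x (anc 1 v) ∧ H.dist x (anc 1 v) + 1 = H.dist x v)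
    {d : ℕ} {v : V} (hv : v ∈ Lv d) :
    ∀ n ≤ d, anc n v ∈ Lv (d - n) ∧ (n < d → H.Adj (anc n v) (anc (n + 1) v)) := by
  have hx0 : ∀ w, H.Reachable x w → H.dist x w ≠ 0 → w ≠ x := by
    intro w _ hd hwx
    rw [hwx, SimpleGraph.dist_self] at hd
    exact hd rfl
  intro n
  induction n with
  | zero =>
    intro _
    rw [hA0, Nat.sub_zero]
    refine ⟨hv, fun hd => ?_⟩
    rw [hLv] at hv
    have := hA1 v hv.1 (hx0 v hv.1 (by omega))
    simpa [← hAadd, hA0] using this.1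
  | succ n ih =>
    intro hn
    obtain ⟨hmem, -⟩ := ih (by omega)
    rw [hLv] at hmem
    have hstep := hA1 (anc n v) hmem.1 (hx0 _ hmem.1 (by omega))
    have hsucc : anc (n + 1) v = anc 1 (anc n v) := by rw [hAadd, Nat.add_comm]
    refine ⟨?_, fun hlt => ?_⟩
    · rw [hLv, hsucc]
      exact ⟨hstep.2.1, by omega⟩
    · have hmem' : anc (n + 1) v ∈ Lv (d - (n + 1)) := by
        rw [hLv, hsucc]; exact ⟨hstep.2.1, by omega⟩
      rw [hLv] at hmem'
      have hstep' := hA1 (anc (n + 1) v) hmem'.1 (hx0 _ hmem'.1 (by omega))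
      have hsucc' : anc (n + 1 + 1) v = anc 1 (anc (n + 1) v) := by
        rw [hAadd, Nat.add_comm]
      rw [hsucc']
      exact hstep'.1

omit [Fintype V] [DecidableEq V] [DecidableRel H.Adj] in
/-- The fork construction of Lemma 2: two vertices `u, v` on the same BFS level `d`, joined by a
path `p` running in the levels `d, d + 1`, whose BFS ancestors first meet after exactly `m` steps,
lie on a cycle of length `|p| + 2m` (the path closed up through the two tree paths).
[cite: BondySimonovits1974, Lemma 2 (proof)] -/
theorem cycle_of_fork (x : V) (Lv : ℕ → Finset V)
    (hLv : ∀ i v, v ∈ Lv i ↔ H.Reachable x v ∧ H.dist x v = i)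
    (anc : ℕ → V → V) (hA0 : ∀ v, anc 0 v = v)
    (hAadd : ∀ k n v, anc k (anc n v) = anc (k + n) v)
    (hA1 : ∀ v, H.Reachable x v → v ≠ x →
      H.Adj v (anc 1 v) ∧ H.Reachable x (anc 1 v) ∧ H.dist x (anc 1 v) + 1 = H.dist x v)
    {d : ℕ} {u v : V} (hu : u ∈ Lv d) (hv : v ∈ Lv d) (p : H.Walk u v) (hp : p.IsPath)
    (hpS : ∀ y ∈ p.support, y ∈ Lv d ∨ y ∈ Lv (d + 1))
    {m : ℕ} (hm1 : 1 ≤ m) (hmd : m ≤ d) (hmeet : anc m u = anc m v)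
    (hfork : anc (m - 1) u ≠ anc (m - 1) v) :
    ∃ (w : V) (q : H.Walk w w), q.IsCycle ∧ q.length = p.length + 2 * m := by
  have huniq : ∀ {i j : ℕ} {y : V}, y ∈ Lv i → y ∈ Lv j → i = j := by
    intro i j y hi hj
    rw [hLv] at hi hj
    exact hi.2.symm.trans hj.2
  have hsu := anc_spec x Lv hLv anc hA0 hAadd hA1 hu
  have hsv := anc_spec x Lv hLv anc hA0 hAadd hA1 hv
  -- the two tree paths
  have htree : ∀ {w : V}, w ∈ Lv d →
      ∃ T : H.Walk w (anc m w), T.IsPath ∧ T.length = m ∧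
        ∀ y, y ∈ T.support ↔ ∃ n ≤ m, anc n w = y := by
    intro w hw
    have hsw := anc_spec x Lv hLv anc hA0 hAadd hA1 hw
    obtain ⟨T, hT, hTl, -, hTs⟩ := exists_path_of_chain (G := H) (fun n => anc n w) m
      (fun n hn => (hsw n (by omega)).2 (by omega))
      (by
        intro n₁ h₁ n₂ h₂ heq
        have e := huniq ((hsw n₁ (by omega)).1) (heq ▸ (hsw n₂ (by omega)).1)
        omega)
    exact ⟨(T.copy (hA0 w) rfl), by simpa using hT, by simpa using hTl,
      by intro y; rw [Walk.support_copy]; exact hTs y⟩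
  obtain ⟨Tu, hTu, hTul, hTus⟩ := htree hu
  obtain ⟨Tv, hTv, hTvl, hTvs⟩ := htree hv
  -- where the tree paths can meet
  have hmeet' : ∀ n₁ ≤ m, ∀ n₂ ≤ m, anc n₁ u = anc n₂ v → n₁ = m ∧ n₂ = m := by
    intro n₁ h₁ n₂ h₂ heq
    have e := huniq ((hsu n₁ (by omega)).1) (heq ▸ (hsv n₂ (by omega)).1)
    have hn : n₁ = n₂ := by omega
    subst hn
    by_contra hne
    have hlt : n₁ < m := by omega
    apply hfork
    have : m - 1 = (m - 1 - n₁) + n₁ := by omega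
    rw [this, ← hAadd, ← hAadd, heq]
  set Tu' : H.Walk (anc m v) u := Tu.reverse.copy hmeet rfl with hTu'
  set q : H.Walk v u := Tv.append Tu' with hq
  have hTu'p : Tu'.IsPath := by simp [hTu', hTu]
  have hjunction : ∀ y ∈ Tv.support, y ∈ Tu'.support → y = anc m v := by
    intro y hyv hyu
    rw [hTu', Walk.support_copy, Walk.support_reverse, List.mem_reverse] at hyu
    obtain ⟨n₂, hn₂, rfl⟩ := (hTvs y).mp hyv
    obtain ⟨n₁, hn₁, heq⟩ := (hTus _).mp hyu
    obtain ⟨-, rfl⟩ := hmeet' n₁ hn₁ n₂ hn₂ heq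
    rfl
  have hqpath : q.IsPath := by
    -- two paths meeting only at the junction vertex concatenate to a path
    rw [hq, Walk.isPath_def, Walk.support_append]
    have hqn := hTu'p.support_nodup
    rw [← Tu'.cons_tail_support, List.nodup_cons] at hqn
    refine List.Nodup.append hTv.support_nodup hqn.2 ?_
    intro y hyp hyq
    exact hqn.1 ((hjunction y hyp (List.mem_of_mem_tail hyq)) ▸ hyq)
  have hql : q.length = 2 * m := by
    rw [hq, Walk.length_append, hTu', Walk.length_copy, Walk.length_reverse, hTul, hTvl]; ring
  refine ⟨u, p.append q, ?_, by rw [Walk.length_append, hql]⟩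
  refine hp.isCycle_append hqpath ?_ (Or.inr (by rw [hql]; omega))
  -- the tails are disjoint: `p` lives on levels `≥ d`, `q` below level `d` except at `u`, `v`
  intro y hyp hyq
  have hyp' : y ∈ p.support := List.mem_of_mem_tail hyp
  have hyu : y ≠ u := by
    have hnd := hp.support_nodup
    rw [← p.cons_tail_support] at hnd
    exact fun h => (List.nodup_cons.mp hnd).1 (h ▸ hyp)
  have hyv : y ≠ v := by
    have hnd := hqpath.support_nodup
    rw [← q.cons_tail_support] at hnd
    exact fun h => (List.nodup_cons.mp hnd).1 (h ▸ hyq)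
  have hyq' : y ∈ q.support := List.mem_of_mem_tail hyq
  rw [hq, Walk.mem_support_append_iff, hTu', Walk.support_copy, Walk.support_reverse,
    List.mem_reverse] at hyq'
  -- so `y` is a proper ancestor of `u` or of `v`, hence on a level `< d`
  have hlow : ∃ n, 1 ≤ n ∧ n ≤ m ∧ (anc n u = y ∨ anc n v = y) := by
    rcases hyq' with hy | hy
    · obtain ⟨n, hn, rfl⟩ := (hTvs y).mp hy
      refine ⟨n, ?_, hn, Or.inr rfl⟩
      by_contra h0
      have : n = 0 := by omega
      exact hyv (by rw [this, hA0])
    · obtain ⟨n, hn, rfl⟩ := (hTus y).mp hy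
      refine ⟨n, ?_, hn, Or.inl rfl⟩
      by_contra h0
      have : n = 0 := by omega
      exact hyu (by rw [this, hA0])
  obtain ⟨n, hn1, hnm, hy⟩ := hlow
  have hylev : y ∈ Lv (d - n) := by
    rcases hy with rfl | rfl
    · exact (hsu n (by omega)).1
    · exact (hsv n (by omega)).1
  rcases hpS y hyp' with h | h
  · have := huniq hylev h; omega
  · have := huniq hylev h; omega

/-! ## The key step (5): two consecutive levels span few edges -/

/-- **The key step of Lemma 2 of Bondy–Simonovits** (relative form, BFS-tree version). In a
bipartite graph without cycles of length `2l`, two consecutive BFS levels `V_d ∪ V_{d+1}`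
(`d + 1 ≤ l`) span at most `4l · (|V_d| + |V_{d+1}|)` edges, i.e. the inner-degree sum is at most
`8l` times the number of vertices. (Paper: "e(H) ≤ 4l·v(H)", inequality (5), obtained from Lemma 1
applied to the red/blue/green colouring of a component; here the component is replaced by a
minimal core and the branching vertex `a` by the nearest common BFS-ancestor of the level-`d`
vertices of the core.) [cite: BondySimonovits1974, Lemma 2 (5)] -/
theorem stepBound (side : V → Bool) (hside : ∀ u v, H.Adj u v → side u ≠ side v)
    (x : V) (Lv : ℕ → Finset V) (hLv : ∀ i v, v ∈ Lv i ↔ H.Reachable x v ∧ H.dist x v = i)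
    (anc : ℕ → V → V) (hA0 : ∀ v, anc 0 v = v)
    (hAadd : ∀ k n v, anc k (anc n v) = anc (k + n) v)
    (hA1 : ∀ v, H.Reachable x v → v ≠ x →
      H.Adj v (anc 1 v) ∧ H.Reachable x (anc 1 v) ∧ H.dist x (anc 1 v) + 1 = H.dist x v)
    (l : ℕ) (hno : ∀ (w : V) (q : H.Walk w w), q.IsCycle → q.length ≠ 2 * l)
    (d : ℕ) (hdl : d + 1 ≤ l) :
    ∑ w ∈ Lv d ∪ Lv (d + 1), (H.neighborFinset w ∩ (Lv d ∪ Lv (d + 1))).card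
      ≤ 8 * l * (Lv d ∪ Lv (d + 1)).card := by
  classical
  by_contra hlt
  push Not at hlt
  set U := Lv d ∪ Lv (d + 1) with hU
  obtain ⟨S, hSU, hSa, hdegS, hconnS⟩ := exists_core (G := H) (8 * l) 1 U (by simpa using hlt)
  -- bookkeeping on levels
  have huniq : ∀ {i j : ℕ} {y : V}, y ∈ Lv i → y ∈ Lv j → i = j := by
    intro i j y hi hj
    rw [hLv] at hi hj
    exact hi.2.symm.trans hj.2
  have hmemU : ∀ {y : V}, y ∈ U → y ∈ Lv d ∨ y ∈ Lv (d + 1) := by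
    intro y hy; simpa [hU] using hy
  have hadjlev : ∀ {u v : V}, u ∈ U → v ∈ U → H.Adj u v →
      (u ∈ Lv d ∧ v ∈ Lv (d + 1)) ∨ (u ∈ Lv (d + 1) ∧ v ∈ Lv d) := by
    intro u v hu hv hadj
    have key : ∀ {i j : ℕ}, u ∈ Lv i → v ∈ Lv j → j = i + 1 ∨ i = j + 1 := by
      intro i j hi hj
      rw [hLv] at hi hj
      have := dist_adj_of_bipartite side hside x hadj hi.1
      omega
    rcases hmemU hu with hu' | hu' <;> rcases hmemU hv with hv' | hv'
    · have := key hu' hv'; omega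
    · exact Or.inl ⟨hu', hv'⟩
    · exact Or.inr ⟨hu', hv'⟩
    · have := key hu' hv'; omega
  have hSne : S.Nonempty := by
    rw [Finset.nonempty_iff_ne_empty]; rintro rfl; simp at hSa
  have hdeg4 : ∀ v ∈ S, 4 * l < (H.neighborFinset v ∩ S).card := by
    intro v hv; have := hdegS v hv; omega
  -- a vertex of `S` on the upper level, and the lower level `W` of `S` is large
  obtain ⟨g, hgS, hgl⟩ : ∃ g ∈ S, g ∈ Lv (d + 1) := by
    obtain ⟨v₀, hv₀⟩ := hSne
    have hne : (H.neighborFinset v₀ ∩ S).Nonempty := by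
      rw [← Finset.card_pos]; have := hdeg4 v₀ hv₀; omega
    obtain ⟨v₁, hv₁⟩ := hne
    rw [Finset.mem_inter, mem_neighborFinset] at hv₁
    rcases hadjlev (hSU hv₀) (hSU hv₁.2) hv₁.1 with h | h
    · exact ⟨v₁, hv₁.2, h.2⟩
    · exact ⟨v₀, hv₀, h.1⟩
  set W := S.filter (· ∈ Lv d) with hW
  have hWS : ∀ {w}, w ∈ W → w ∈ S := fun hw => (Finset.mem_filter.mp hw).1
  have hWd : ∀ {w}, w ∈ W → w ∈ Lv d := fun hw => (Finset.mem_filter.mp hw).2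
  have hWcard : 4 * l < W.card := by
    refine (hdeg4 g hgS).trans_le (Finset.card_le_card ?_)
    intro y hy
    rw [Finset.mem_inter, mem_neighborFinset] at hy
    rw [hW, Finset.mem_filter]
    refine ⟨hy.2, ?_⟩
    rcases hadjlev (hSU hgS) (hSU hy.2) hy.1 with h | h
    · exact absurd (huniq hgl h.1) (by omega)
    · exact h.2
  have hl1 : 1 ≤ l := by omega
  have hd1 : 1 ≤ d := by
    by_contra hd0
    have hd0 : d = 0 := by omega
    have hsub : W ⊆ {x} := by
      intro w hw
      have := hWd hw
      rw [hd0, hLv] at this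
      rw [Finset.mem_singleton]
      exact (this.1.dist_eq_zero_iff).mp this.2 |>.symm
    have := Finset.card_le_card hsub
    rw [Finset.card_singleton] at this
    omega
  -- the nearest common ancestor of `W`
  have hanc := fun {w : V} (hw : w ∈ Lv d) => anc_spec x Lv hLv anc hA0 hAadd hA1 hw
  have hex : ∃ m, ∀ w ∈ W, ∀ w' ∈ W, anc m w = anc m w' := by
    refine ⟨d, fun w hw w' hw' => ?_⟩
    have h1 := (hanc (hWd hw) d le_rfl).1
    have h2 := (hanc (hWd hw') d le_rfl).1
    rw [Nat.sub_self, hLv] at h1 h2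
    rw [← (h1.1.dist_eq_zero_iff).mp h1.2, ← (h2.1.dist_eq_zero_iff).mp h2.2]
  set m₀ := Nat.find hex with hm₀
  have hm₀d : m₀ ≤ d := by
    rw [hm₀]; apply Nat.find_min'
    intro w hw w' hw'
    have h1 := (hanc (hWd hw) d le_rfl).1
    have h2 := (hanc (hWd hw') d le_rfl).1
    rw [Nat.sub_self, hLv] at h1 h2
    rw [← (h1.1.dist_eq_zero_iff).mp h1.2, ← (h2.1.dist_eq_zero_iff).mp h2.2]
  have hPm₀ : ∀ w ∈ W, ∀ w' ∈ W, anc m₀ w = anc m₀ w' := Nat.find_spec hex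
  have hm₀1 : 1 ≤ m₀ := by
    by_contra h0
    have h0 : m₀ = 0 := by omega
    have : W.card ≤ 1 := by
      rw [Finset.card_le_one]
      intro w hw w' hw'
      have := hPm₀ w hw w' hw'
      rwa [h0, hA0, hA0] at this
    omega
  have hfork : ∃ w₁ ∈ W, ∃ w₂ ∈ W, anc (m₀ - 1) w₁ ≠ anc (m₀ - 1) w₂ := by
    have := Nat.find_min hex (show m₀ - 1 < m₀ by omega)
    push Not at this
    exact this
  obtain ⟨w₁, hw₁, w₂, hw₂, hne12⟩ := hfork
  -- the red / blue / green colouring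
  set c : V → ℕ := fun y =>
    if y ∈ Lv (d + 1) then 2 else if anc (m₀ - 1) y = anc (m₀ - 1) w₁ then 0 else 1 with hc
  have hnot : ∀ {w}, w ∈ Lv d → w ∉ Lv (d + 1) := by
    intro w hw hw'
    have := huniq hw hw'
    omega
  have hc1 : c w₁ = 0 := by simp [hc, hnot (hWd hw₁)]
  have hc2 : c w₂ = 1 := by simp [hc, hnot (hWd hw₂), Ne.symm hne12]
  have hcg : c g = 2 := by simp [hc, hgl]
  -- periodicity of the colouring on `S`
  set t := 2 * (l - m₀) with ht
  have ht1 : 1 ≤ t := by omega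
  have hdeg' : ∀ v ∈ S, 2 * t + 1 ≤ (H.neighborFinset v ∩ S).card := by
    intro v hv; have := hdeg4 v hv; omega
  have hpar : ∀ {u v : V} (p : H.Walk u v), (∀ y ∈ p.support, y ∈ U) →
      ((u ∈ Lv d ↔ v ∈ Lv d) ↔ Even p.length) := by
    intro u v p
    induction p with
    | nil => intro _; simp
    | @cons a b e h q ih =>
      intro hs
      rw [Walk.support_cons] at hs
      have ha : a ∈ U := hs a (List.mem_cons_self ..)
      have hq : ∀ y ∈ q.support, y ∈ U := fun y hy => hs y (List.mem_cons_of_mem _ hy)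
      have hb : b ∈ U := hq b q.start_mem_support
      have ih' := ih hq
      rw [Walk.length_cons, Nat.even_add_one, ← ih']
      have hab : (a ∈ Lv d ↔ ¬ b ∈ Lv d) := by
        rcases hadjlev ha hb h with h' | h'
        · exact ⟨fun _ hb' => hnot hb' h'.2, fun _ => h'.1⟩
        · exact ⟨fun ha' => absurd h'.1 (hnot ha'), fun hb' => absurd h'.2 hb'⟩
      tauto
  have hcper : ∀ {u v : V} (p : H.Walk u v), p.IsPath → p.length = t →
      (∀ y ∈ p.support, y ∈ S) → c u = c v := by
    intro u v p hp hpl hpS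
    have hpU : ∀ y ∈ p.support, y ∈ U := fun y hy => hSU (hpS y hy)
    have huS : u ∈ S := hpS u p.start_mem_support
    have hvS : v ∈ S := hpS v p.end_mem_support
    have hsame : (u ∈ Lv d ↔ v ∈ Lv d) :=
      (hpar p hpU).mpr (by rw [hpl, ht]; exact even_two_mul _)
    by_cases hu : u ∈ Lv (d + 1)
    · have hu' : u ∉ Lv d := fun h => hnot h hu
      have hv' : v ∉ Lv d := fun h => hu' (hsame.mpr h)
      have hv : v ∈ Lv (d + 1) := (hmemU (hSU hvS)).resolve_left hv'
      simp [hc, hu, hv]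
    · have hu' : u ∈ Lv d := (hmemU (hSU huS)).resolve_right hu
      have hv' : v ∈ Lv d := hsame.mp hu'
      have hv : v ∉ Lv (d + 1) := hnot hv'
      by_contra hne
      have hfork' : anc (m₀ - 1) u ≠ anc (m₀ - 1) v := by
        intro heq
        apply hne
        simp [hc, hu, hv, heq]
      have hmeet : anc m₀ u = anc m₀ v :=
        hPm₀ u (Finset.mem_filter.mpr ⟨huS, hu'⟩) v (Finset.mem_filter.mpr ⟨hvS, hv'⟩)
      obtain ⟨w, q, hq, hql⟩ := cycle_of_fork x Lv hLv anc hA0 hAadd hA1 hu' hv' p hp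
        (fun y hy => hmemU (hpU y hy)) hm₀1 hm₀d hmeet hfork'
      exact hno w q hq (by rw [hql, hpl, ht]; omega)
  -- Lemma 1 now yields the contradiction
  have h2col := lemma1 (G := H) S hSne t ht1 hdeg' hconnS c hcper
  have := two_of_three h2col (hWS hw₁) (hWS hw₂) hgS
  rw [hc1, hc2, hcg] at this
  omega

/-! ## Growth of the levels and Lemma 2 -/

/-- Degrees split over the neighbouring levels: a vertex on BFS level `d ≥ 1` of a bipartite graph
has all its neighbours on the levels `d - 1` and `d + 1`. [folklore] -/
theorem degree_le_levels (side : V → Bool) (hside : ∀ u v, H.Adj u v → side u ≠ side v)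
    (x : V) (Lv : ℕ → Finset V) (hLv : ∀ i v, v ∈ Lv i ↔ H.Reachable x v ∧ H.dist x v = i)
    {d : ℕ} (hd : 1 ≤ d) {w : V} (hw : w ∈ Lv d) :
    H.degree w ≤ (H.neighborFinset w ∩ Lv (d - 1)).card + (H.neighborFinset w ∩ Lv (d + 1)).card := by
  classical
  rw [← card_neighborFinset_eq_degree]
  refine le_trans (Finset.card_le_card ?_) (Finset.card_union_le _ _)
  intro y hy
  rw [mem_neighborFinset] at hy
  rw [hLv] at hw
  have hreach : H.Reachable x y := hw.1.trans hy.reachable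
  rw [Finset.mem_union, Finset.mem_inter, Finset.mem_inter, mem_neighborFinset, hLv, hLv]
  rcases dist_adj_of_bipartite side hside x hy hw.1 with h | h
  · exact Or.inr ⟨hy, hreach, by omega⟩
  · exact Or.inl ⟨hy, hreach, by omega⟩

/-- Edges between two consecutive BFS levels, counted from below, are half the inner-degree sum of
the union of the two levels (there are no edges inside a level of a bipartite graph).
[folklore] -/
theorem two_mul_crossSum_eq (side : V → Bool) (hside : ∀ u v, H.Adj u v → side u ≠ side v)
    (x : V) (Lv : ℕ → Finset V) (hLv : ∀ i v, v ∈ Lv i ↔ H.Reachable x v ∧ H.dist x v = i)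
    (d : ℕ) :
    2 * ∑ w ∈ Lv d, (H.neighborFinset w ∩ Lv (d + 1)).card
      = ∑ w ∈ Lv d ∪ Lv (d + 1), (H.neighborFinset w ∩ (Lv d ∪ Lv (d + 1))).card := by
  classical
  have huniq : ∀ {i j : ℕ} {y : V}, y ∈ Lv i → y ∈ Lv j → i = j := by
    intro i j y hi hj
    rw [hLv] at hi hj
    exact hi.2.symm.trans hj.2
  have hnoin : ∀ {i : ℕ} {u v : V}, u ∈ Lv i → v ∈ Lv i → ¬ H.Adj u v := by
    intro i u v hu hv hadj
    rw [hLv] at hu hv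
    have := dist_adj_of_bipartite side hside x hadj hu.1
    omega
  have hdisj : Disjoint (Lv d) (Lv (d + 1)) := by
    rw [Finset.disjoint_left]
    intro y hy hy'
    have := huniq hy hy'
    omega
  rw [Finset.sum_union hdisj]
  have h1 : ∀ w ∈ Lv d, (H.neighborFinset w ∩ (Lv d ∪ Lv (d + 1))).card
      = (H.neighborFinset w ∩ Lv (d + 1)).card := by
    intro w hw
    congr 1
    ext y
    simp only [Finset.mem_inter, mem_neighborFinset, Finset.mem_union]
    constructor
    · rintro ⟨hadj, hy | hy⟩
      · exact absurd hadj (hnoin hw hy)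
      · exact ⟨hadj, hy⟩
    · rintro ⟨hadj, hy⟩
      exact ⟨hadj, Or.inr hy⟩
  have h2 : ∀ w ∈ Lv (d + 1), (H.neighborFinset w ∩ (Lv d ∪ Lv (d + 1))).card
      = (H.neighborFinset w ∩ Lv d).card := by
    intro w hw
    congr 1
    ext y
    simp only [Finset.mem_inter, mem_neighborFinset, Finset.mem_union]
    constructor
    · rintro ⟨hadj, hy | hy⟩
      · exact ⟨hadj, hy⟩
      · exact absurd hadj (hnoin hw hy)
    · rintro ⟨hadj, hy⟩
      exact ⟨hadj, Or.inl hy⟩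
  rw [Finset.sum_congr rfl h1, Finset.sum_congr rfl h2]
  -- double counting of the edges between the two levels
  have hdc := Finset.sum_card_bipartiteAbove_eq_sum_card_bipartiteBelow
    (r := fun a b => H.Adj a b) (s := Lv d) (t := Lv (d + 1))
  have e1 : ∀ a ∈ Lv d, ((Lv (d + 1)).bipartiteAbove (fun a b => H.Adj a b) a).card
      = (H.neighborFinset a ∩ Lv (d + 1)).card := by
    intro a _
    congr 1
    ext b
    simp [Finset.mem_bipartiteAbove, and_comm]
  have e2 : ∀ b ∈ Lv (d + 1), ((Lv d).bipartiteBelow (fun a b => H.Adj a b) b).card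
      = (H.neighborFinset b ∩ Lv d).card := by
    intro b _
    congr 1
    ext a
    simp [Finset.mem_bipartiteBelow, and_comm, adj_comm]
  rw [Finset.sum_congr rfl e1, Finset.sum_congr rfl e2] at hdc
  omega

omit [DecidableEq V] in
/-- **Lemma 2 of Bondy–Simonovits** (BFS growth). Let `H` be a bipartite graph on `n` vertices in
which every vertex reachable from `x` has degree at least `s`, where `s ≥ 43 l` and
`s ≥ 5 l n^{1/l}` (`l ≥ 1`; the paper asks `s ≥ 50 l`). Then `H` contains a cycle of length
exactly `2l`. (If not, the BFS levels from `x` would grow by a factor `s/(5l) ≥ n^{1/l}` at each of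
the first `l` steps.) [cite: BondySimonovits1974, Lemma 2] -/
theorem lemma2 (side : V → Bool) (hside : ∀ u v, H.Adj u v → side u ≠ side v) (x : V)
    (s l : ℕ) (hl : 1 ≤ l) (hs : 43 * l ≤ s)
    (hsn : 5 * (l : ℝ) * (Fintype.card V : ℝ) ^ (1 / (l : ℝ)) ≤ s)
    (hdeg : ∀ v, H.Reachable x v → s ≤ H.degree v) :
    ∃ (u : V) (p : H.Walk u u), p.IsCycle ∧ p.length = 2 * l := by
  classical
  by_contra hno
  push Not at hno
  -- BFS levels and the BFS tree
  set Lv : ℕ → Finset V := fun i => Finset.univ.filter (fun v => H.Reachable x v ∧ H.dist x v = i)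
    with hLvdef
  have hLv : ∀ i v, v ∈ Lv i ↔ H.Reachable x v ∧ H.dist x v = i := by
    intro i v; simp [hLvdef]
  have hparex : ∀ v : V, ∃ w : V, (H.Reachable x v ∧ v ≠ x) →
      H.Adj v w ∧ H.Reachable x w ∧ H.dist x w + 1 = H.dist x v := by
    intro v
    by_cases h : H.Reachable x v ∧ v ≠ x
    · obtain ⟨w, hw⟩ := exists_parent x h.1 h.2
      exact ⟨w, fun _ => hw⟩
    · exact ⟨v, fun h' => absurd h' h⟩
  choose par hpar using hparex
  set anc : ℕ → V → V := fun n => par^[n] with hancdef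
  have hA0 : ∀ v, anc 0 v = v := fun v => rfl
  have hAadd : ∀ k n v, anc k (anc n v) = anc (k + n) v := fun k n v =>
    (Function.iterate_add_apply par k n v).symm
  have hA1 : ∀ v, H.Reachable x v → v ≠ x →
      H.Adj v (anc 1 v) ∧ H.Reachable x (anc 1 v) ∧ H.dist x (anc 1 v) + 1 = H.dist x v :=
    fun v hv hne => by simpa [hancdef] using hpar v ⟨hv, hne⟩
  have huniq : ∀ {i j : ℕ} {y : V}, y ∈ Lv i → y ∈ Lv j → i = j := by
    intro i j y hi hj
    rw [hLv] at hi hj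
    exact hi.2.symm.trans hj.2
  -- the level sizes
  set N : ℕ → ℝ := fun i => ((Lv i).card : ℝ) with hNdef
  have hN0 : N 0 = 1 := by
    have : Lv 0 = {x} := by
      ext v
      rw [hLv, Finset.mem_singleton]
      constructor
      · rintro ⟨hr, hd⟩; exact (hr.dist_eq_zero_iff.mp hd).symm
      · rintro rfl; exact ⟨Reachable.refl _, SimpleGraph.dist_self⟩
    simp [hNdef, this]
  have hN1 : (s : ℝ) ≤ N 1 := by
    have h1 : s ≤ (Lv 1).card := by
      refine (hdeg x (Reachable.refl _)).trans ?_
      rw [← card_neighborFinset_eq_degree]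
      apply Finset.card_le_card
      intro y hy
      rw [mem_neighborFinset] at hy
      rw [hLv]
      exact ⟨hy.reachable, SimpleGraph.dist_eq_one_iff_adj.mpr hy⟩
    simp only [hNdef]
    exact_mod_cast h1
  have hNnn : ∀ i, 0 ≤ N i := fun i => by simp [hNdef]
  -- the cross sums between consecutive levels are small (no `C_{2l}`!)
  have hcross : ∀ d, d + 1 ≤ l →
      2 * ((∑ w ∈ Lv d, (H.neighborFinset w ∩ Lv (d + 1)).card : ℕ) : ℝ)
        ≤ 8 * l * (N d + N (d + 1)) := by
    intro d hd
    have h := stepBound side hside x Lv hLv anc hA0 hAadd hA1 l hno d hd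
    rw [← two_mul_crossSum_eq side hside x Lv hLv d] at h
    have hdisj : Disjoint (Lv d) (Lv (d + 1)) := by
      rw [Finset.disjoint_left]
      intro y hy hy'
      have := huniq hy hy'
      omega
    rw [Finset.card_union_of_disjoint hdisj] at h
    simp only [hNdef]
    exact_mod_cast h
  -- the recursion `s N_d ≤ 4l (N_{d-1} + N_d) + 4l (N_d + N_{d+1})`
  have hrec : ∀ d, 1 ≤ d → d + 1 ≤ l →
      (s : ℝ) * N d ≤ 4 * l * (N (d - 1) + N d) + 4 * l * (N d + N (d + 1)) := by
    intro d hd1 hdl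
    have hX := hcross (d - 1) (by omega)
    have hY := hcross d hdl
    have hdm : d - 1 + 1 = d := by omega
    rw [hdm] at hX
    -- `s |V_d| ≤ Σ_{w ∈ V_d} deg w ≤ X + Y`
    have hdegsum : s * (Lv d).card ≤ ∑ w ∈ Lv d, (H.neighborFinset w ∩ Lv (d - 1)).card
        + ∑ w ∈ Lv d, (H.neighborFinset w ∩ Lv (d + 1)).card := by
      rw [← Finset.sum_add_distrib]
      have : s * (Lv d).card = ∑ w ∈ Lv d, s := by simp [mul_comm]
      rw [this]
      apply Finset.sum_le_sum
      intro w hw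
      have hr : H.Reachable x w := ((hLv d w).mp hw).1
      exact (hdeg w hr).trans (degree_le_levels side hside x Lv hLv hd1 hw)
    -- the first sum is the cross sum of the pair `(d-1, d)` counted from above
    have hswap : ∑ w ∈ Lv d, (H.neighborFinset w ∩ Lv (d - 1)).card
        = ∑ w ∈ Lv (d - 1), (H.neighborFinset w ∩ Lv d).card := by
      have hdc := Finset.sum_card_bipartiteAbove_eq_sum_card_bipartiteBelow
        (r := fun a b => H.Adj a b) (s := Lv (d - 1)) (t := Lv d)
      have e1 : ∀ a ∈ Lv (d - 1), ((Lv d).bipartiteAbove (fun a b => H.Adj a b) a).card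
          = (H.neighborFinset a ∩ Lv d).card := by
        intro a _
        congr 1
        ext b
        simp [Finset.mem_bipartiteAbove, and_comm]
      have e2 : ∀ b ∈ Lv d, ((Lv (d - 1)).bipartiteBelow (fun a b => H.Adj a b) b).card
          = (H.neighborFinset b ∩ Lv (d - 1)).card := by
        intro b _
        congr 1
        ext a
        simp [Finset.mem_bipartiteBelow, and_comm, adj_comm]
      rw [Finset.sum_congr rfl e1, Finset.sum_congr rfl e2] at hdc
      exact hdc.symm
    rw [hswap] at hdegsum
    have hcast : (s : ℝ) * N d ≤ ((∑ w ∈ Lv (d - 1), (H.neighborFinset w ∩ Lv d).card : ℕ) : ℝ)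
        + ((∑ w ∈ Lv d, (H.neighborFinset w ∩ Lv (d + 1)).card : ℕ) : ℝ) := by
      simp only [hNdef]
      exact_mod_cast hdegsum
    linarith
  -- growth by the factor `ρ = s / (5l)`
  have hl0 : (0 : ℝ) < l := by exact_mod_cast hl
  have hs0 : (0 : ℝ) < s := by
    have : (43 : ℝ) * l ≤ s := by exact_mod_cast hs
    linarith
  have hs43 : (43 : ℝ) * l ≤ s := by exact_mod_cast hs
  set ρ : ℝ := s / (5 * l) with hρ
  have hρ0 : 0 ≤ ρ := by rw [hρ]; positivity
  have hρs : ρ * (5 * l) = s := by rw [hρ]; field_simp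
  have hgrow : ∀ d, d + 1 ≤ l → ρ * N d ≤ N (d + 1) := by
    intro d
    induction d with
    | zero =>
      intro _
      rw [hN0, mul_one]
      refine le_trans ?_ hN1
      rw [hρ, div_le_iff₀ (by positivity)]
      have h1 : (1 : ℝ) ≤ l := by exact_mod_cast hl
      nlinarith [hs0.le, h1]
    | succ d ih =>
      intro hdl
      have hprev := ih (by omega)
      have hr := hrec (d + 1) (by omega) hdl
      simp only [Nat.add_sub_cancel] at hr
      -- clear denominators: everything times `5 l`
      have hA : (s : ℝ) * N d ≤ 5 * l * N (d + 1) := by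
        have := mul_le_mul_of_nonneg_right hprev (by positivity : (0 : ℝ) ≤ 5 * l)
        rw [mul_comm, ← mul_assoc, mul_comm (5 * (l : ℝ)) ρ, hρs] at this
        linarith
      have hB := hNnn (d + 1)
      have hC := hNnn (d + 1 + 1)
      have hquad : (40 : ℝ) * l * s + 100 * l ^ 2 ≤ (s : ℝ) ^ 2 := by nlinarith
      have P1 := mul_le_mul_of_nonneg_left hr hs0.le
      have P2 := mul_le_mul_of_nonneg_left hA (by positivity : (0 : ℝ) ≤ 4 * l)
      have P3 := mul_le_mul_of_nonneg_right hquad hB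
      have key : (s : ℝ) * ((s : ℝ) * N (d + 1)) ≤ (s : ℝ) * (5 * l * N (d + 1 + 1)) := by
        nlinarith
      have := le_of_mul_le_mul_left key hs0
      calc ρ * N (d + 1) = s * N (d + 1) / (5 * l) := by rw [hρ]; ring
        _ ≤ 5 * l * N (d + 1 + 1) / (5 * l) := by
          apply div_le_div_of_nonneg_right this (by positivity)
        _ = N (d + 1 + 1) := by field_simp
  have hpow : ∀ d ≤ l, ρ ^ d ≤ N d := by
    intro d
    induction d with
    | zero => intro _; rw [pow_zero, hN0]
    | succ d ih =>
      intro hd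
      have h1 := ih (by omega)
      have h2 := hgrow d hd
      calc ρ ^ (d + 1) = ρ * ρ ^ d := by ring
        _ ≤ ρ * N d := mul_le_mul_of_nonneg_left h1 hρ0
        _ ≤ N (d + 1) := h2
  -- `ρ ^ l ≥ n`
  set n : ℕ := Fintype.card V with hn
  have hρn : (n : ℝ) ≤ ρ ^ l := by
    have hnn : (0 : ℝ) ≤ n := by positivity
    have h1 : (n : ℝ) ^ (1 / (l : ℝ)) ≤ ρ := by
      rw [hρ, le_div_iff₀ (by positivity)]
      linarith
    have h2 := pow_le_pow_left₀ (by positivity) h1 l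
    have h3 : ((n : ℝ) ^ (1 / (l : ℝ))) ^ l = n := by
      rw [← Real.rpow_natCast, ← Real.rpow_mul hnn]
      have : 1 / (l : ℝ) * l = 1 := by field_simp
      rw [this, Real.rpow_one]
    rw [h3] at h2
    exact h2
  -- but the two levels `0` and `l` are disjoint
  have hdisj : Disjoint (Lv 0) (Lv l) := by
    rw [Finset.disjoint_left]
    intro y hy hy'
    have := huniq hy hy'
    omega
  have hcard : (Lv 0).card + (Lv l).card ≤ n := by
    rw [← Finset.card_union_of_disjoint hdisj]
    exact Finset.card_le_univ _
  have hcast : N 0 + N l ≤ n := by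
    simp only [hNdef]; exact_mod_cast hcard
  have := hpow l le_rfl
  linarith

end BondySimonovits1974

end Literature.Combinatorics.SimpleGraph
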